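import Literature.Analysis.FunctionSpaces.TorusDerivBounds
import Literature.Analysis.FunctionSpaces.TorusChainRule
import Literature.Analysis.FunctionSpaces.TorusCalculusProofs
import HarnessLib

/-!
# Differential monomials in a family of scalar fields on the flat torus, and the bookkeeping of
# their partial derivatives (Leibniz + chain rule, symbolically)

Analysis/FunctionSpaces support file (definitions with proved API; no named facts). The `H^m`
energy method for quasilinear hyperbolic (or parabolic) systems (Majda 1984, Ch. 2, proof of
Thm 2.2; Taylor, *PDE III*, Ch. 13 §3 and Ch. 16 §1; Klainerman–Majda / Moser calculus
inequalities) estimates COMMUTATORS `∂^w(a(W) ∂W) - a(W) ∂^w ∂W`: finite sums of products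
`γ(W) · ∂^{v₁}W^{α₁} ⋯ ∂^{v_r}W^{α_r}` of a smooth function of the unknowns with several
partial-derivative words of their components, `|v₁| + … + |v_r|` fixed. Each such product is then
bounded in `L²` by putting one factor in `L²` and the others in `L^∞`. The only structural facts
used are (i) how many factors there are, (ii) the orders `|v_l|` (each `≥ 1`, their sum, their
maximum), (iii) that `γ` is smooth near the range of the unknowns. This file provides that
bookkeeping once and for all, for scalar torus fields `φ : κ → 𝕋^d → ℝ` and coefficients depending
on two designated fields `φ a, φ b` (for the Euler system: density and temperature):

* `Torus.DiffMonomial d κ` — a coefficient `g : ℝ → ℝ → ℝ` and a list of factors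
  `(v, k) : List d × κ`; `DiffMonomial.eval φ a b T x = g(φ a x, φ b x) · Π_l ∂^{v_l} (φ k_l) x`
  (`Torus.iterPartialDeriv`); `order` (sum of the `|v_l|`), `width` (number of factors),
  `Proper` (all `v_l ≠ []`), `maxOrder`;
* `DiffMonomial.dExp a b i T` — **the `∂ᵢ`-expansion**: the list of monomials whose evaluations sum
  to `∂ᵢ (eval T)` (`partialDeriv_eval`): the chain rule on the coefficient
  (`Torus.partialDeriv_comp₂`) contributes `∂₁g · ∂ᵢφ_a · Π` and `∂₂g · ∂ᵢφ_b · Π`, the Leibniz rule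
  on the product contributes one monomial per factor (`dFactors`, `partialDeriv_prodEval`);
* `DiffMonomial.wExp a b w T` — the iterated expansion: `∂^w (eval T) = Σ_{T' ∈ wExp w T} eval T'`
  (`iterPartialDeriv_eval`), with the invariants `order T' = order T + |w|`,
  `width T ≤ width T' ≤ width T + |w|`, `Proper T → Proper T'`, and smoothness of all
  coefficients on the open set on which `g` is smooth (`mem_wExp_*`);
* `DiffMonomial.mul`, `DiffMonomial.single`, `DiffMonomial.scale` and their evaluations.

Everything is folklore calculus (multivariate Leibniz and Faà di Bruno bookkeeping in the form
"all terms of the same shape, induction at fixed shape", as in the tree's `CoordWordDeriv` /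
`JetComposition` on `ℝⁿ`); here on `𝕋^d` in the currency `Torus.partialDeriv` /
`Torus.iterPartialDeriv` of `TorusCalculus` / `TorusDerivBounds`, which is the one in which the
torus energy integrals and the Sobolev sup bound (`TorusSobolevSup`) are written.

## References

* A. Majda, *Compressible Fluid Flow and Systems of Conservation Laws in Several Space
  Variables*, Springer 1984, Ch. 2, §2.1, proof of Thm 2.2 (the commutator terms). [Majda1984]
* M. E. Taylor, *Partial Differential Equations III*, 2nd ed., Springer 2011, Ch. 13, §3
  (Moser estimates: products and compositions). [TaylorPDEIII2011]
* L. C. Evans, *Partial Differential Equations*, 2nd ed., AMS 2010, App. C.2 (Leibniz formula).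
  [Evans2010]
-/

noncomputable section

open Set Function
open scoped ContDiff

namespace Literature.Analysis.FunctionSpaces

namespace Torus

variable {d : Type*} {κ : Type*}

/-- **A differential monomial** in scalar torus fields indexed by `κ`: a coefficient `g(r, θ)`
(to be evaluated at two designated fields) and a list of factors `(v, k)` standing for
`∂^v φ_k`. [cite: TaylorPDEIII2011, Ch. 13 §3] -/
structure DiffMonomial (d : Type*) (κ : Type*) where
  /-- the coefficient, a function of the two designated fields -/
  coeff : ℝ → ℝ → ℝ
  /-- the factors `∂^{v} φ_k`, as pairs `(v, k)` -/
  factors : List (List d × κ)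

namespace DiffMonomial

/-! ### Evaluation and shape -/

section Shape

variable [Fintype d] [DecidableEq d]

/-- The product of the factors `Π_l ∂^{v_l} φ_{k_l} (x)`. [folklore] -/
def prodEval (φ : κ → UnitAddTorus d → ℝ) (fs : List (List d × κ)) (x : UnitAddTorus d) : ℝ :=
  (fs.map fun f => iterPartialDeriv f.1 (φ f.2) x).prod

/-- **Evaluation** of a monomial on the fields `φ`, the coefficient being taken at
`(φ a x, φ b x)`: `g(φ a x, φ b x) · Π_l ∂^{v_l} φ_{k_l} (x)`. [cite: TaylorPDEIII2011, Ch. 13 §3] -/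
def eval (φ : κ → UnitAddTorus d → ℝ) (a b : κ) (T : DiffMonomial d κ) (x : UnitAddTorus d) : ℝ :=
  T.coeff (φ a x) (φ b x) * prodEval φ T.factors x

omit [Fintype d] in
/-- `prodEval` of the empty list is `1`. [folklore] -/
@[simp] theorem prodEval_nil (φ : κ → UnitAddTorus d → ℝ) (x : UnitAddTorus d) :
    prodEval φ [] x = 1 := by simp [prodEval]

omit [Fintype d] in
/-- `prodEval` of a cons. [folklore] -/
@[simp] theorem prodEval_cons (φ : κ → UnitAddTorus d → ℝ) (f : List d × κ) (fs : List (List d × κ))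
    (x : UnitAddTorus d) :
    prodEval φ (f :: fs) x = iterPartialDeriv f.1 (φ f.2) x * prodEval φ fs x := by
  simp [prodEval]

omit [Fintype d] in
/-- `prodEval` of an append. [folklore] -/
theorem prodEval_append (φ : κ → UnitAddTorus d → ℝ) (fs gs : List (List d × κ)) (x : UnitAddTorus d) :
    prodEval φ (fs ++ gs) x = prodEval φ fs x * prodEval φ gs x := by
  simp [prodEval, List.prod_append]

omit [Fintype d] in
/-- Unfolding `eval`. [folklore] -/
theorem eval_def (φ : κ → UnitAddTorus d → ℝ) (a b : κ) (T : DiffMonomial d κ) (x : UnitAddTorus d) :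
    eval φ a b T x = T.coeff (φ a x) (φ b x) * prodEval φ T.factors x := rfl

end Shape

/-- The **order** of a monomial: the total number of derivatives `Σ_l |v_l|`. [folklore] -/
def order (T : DiffMonomial d κ) : ℕ := (T.factors.map fun f => f.1.length).sum

/-- The **width** of a monomial: the number of factors. [folklore] -/
def width (T : DiffMonomial d κ) : ℕ := T.factors.length

/-- The **maximal order** of a factor (`0` for the empty product). [folklore] -/
def maxOrder (T : DiffMonomial d κ) : ℕ := (T.factors.map fun f => f.1.length).foldr max 0

/-- A monomial is **proper** if every factor carries at least one derivative. [folklore] -/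
def Proper (T : DiffMonomial d κ) : Prop := ∀ f ∈ T.factors, f.1 ≠ []

/-- The order of a list of factors. [folklore] -/
def orderOf (fs : List (List d × κ)) : ℕ := (fs.map fun f => f.1.length).sum

/-- `order` through `orderOf`. [folklore] -/
theorem order_eq (T : DiffMonomial d κ) : T.order = orderOf T.factors := rfl

/-- `orderOf` of a cons. [folklore] -/
@[simp] theorem orderOf_cons (f : List d × κ) (fs : List (List d × κ)) :
    orderOf (f :: fs) = f.1.length + orderOf fs := by simp [orderOf]

/-- `orderOf []`. [folklore] -/
@[simp] theorem orderOf_nil : orderOf ([] : List (List d × κ)) = 0 := by simp [orderOf]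

/-- `orderOf` of an append. [folklore] -/
theorem orderOf_append (fs gs : List (List d × κ)) : orderOf (fs ++ gs) = orderOf fs + orderOf gs := by
  simp [orderOf, List.sum_append]

/-- An element of a list of naturals is at most its `foldr max 0`. [folklore] -/
theorem le_foldr_max_of_mem {l : List ℕ} {n : ℕ} (h : n ∈ l) : n ≤ l.foldr max 0 := by
  induction l with
  | nil => simp at h
  | cons m l ih =>
    simp only [List.foldr_cons]
    rcases List.mem_cons.1 h with rfl | h'
    · exact le_max_left _ _
    · exact (ih h').trans (le_max_right _ _)

/-- A nonempty list of naturals attains its `foldr max 0`. [folklore] -/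
theorem exists_mem_eq_foldr_max {l : List ℕ} (h : l ≠ []) : ∃ n ∈ l, n = l.foldr max 0 := by
  induction l with
  | nil => exact absurd rfl h
  | cons m l ih =>
    simp only [List.foldr_cons]
    by_cases hl : l = []
    · subst hl; exact ⟨m, by simp, by simp⟩
    · obtain ⟨n, hn, hne⟩ := ih hl
      rcases le_total m (l.foldr max 0) with hle | hle
      · exact ⟨n, List.mem_cons_of_mem _ hn, by rw [max_eq_right hle, hne]⟩
      · exact ⟨m, List.mem_cons_self, by rw [max_eq_left hle]⟩

/-- `foldr max 0 ≤ sum` for lists of naturals. [folklore] -/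
theorem foldr_max_le_sum (l : List ℕ) : l.foldr max 0 ≤ l.sum := by
  induction l with
  | nil => simp
  | cons m l ih =>
    simp only [List.foldr_cons, List.sum_cons]
    exact max_le (Nat.le_add_right _ _) (ih.trans (Nat.le_add_left _ _))

/-- Every factor order is at most `maxOrder`. [folklore] -/
theorem length_le_maxOrder {T : DiffMonomial d κ} {f : List d × κ} (hf : f ∈ T.factors) :
    f.1.length ≤ T.maxOrder :=
  le_foldr_max_of_mem (List.mem_map.2 ⟨f, hf, rfl⟩)

/-- A nonempty monomial has a factor of maximal order. [folklore] -/
theorem exists_length_eq_maxOrder (T : DiffMonomial d κ) (h : T.factors ≠ []) :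
    ∃ f ∈ T.factors, f.1.length = T.maxOrder := by
  obtain ⟨n, hn, hne⟩ := exists_mem_eq_foldr_max (l := T.factors.map fun f => f.1.length) (by simpa using h)
  obtain ⟨f, hf, rfl⟩ := List.mem_map.1 hn
  exact ⟨f, hf, hne⟩

/-- `maxOrder ≤ order`. [folklore] -/
theorem maxOrder_le_order (T : DiffMonomial d κ) : T.maxOrder ≤ T.order :=
  foldr_max_le_sum _

/-! ### Algebra: products, single factors, scaling -/

/-- The product of two monomials (coefficients multiply, factor lists concatenate). [folklore] -/
def mul (T₁ T₂ : DiffMonomial d κ) : DiffMonomial d κ :=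
  ⟨fun r θ => T₁.coeff r θ * T₂.coeff r θ, T₁.factors ++ T₂.factors⟩

/-- The monomial `∂^v φ_k` (coefficient `1`). [folklore] -/
def single (v : List d) (k : κ) : DiffMonomial d κ := ⟨fun _ _ => 1, [(v, k)]⟩

/-- Multiplying the coefficient by a function of the designated fields. [folklore] -/
def scale (g : ℝ → ℝ → ℝ) (T : DiffMonomial d κ) : DiffMonomial d κ :=
  ⟨fun r θ => g r θ * T.coeff r θ, T.factors⟩

section AlgebraEval

variable [Fintype d] [DecidableEq d]

omit [Fintype d] in
/-- Evaluation of a product. [folklore] -/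
theorem eval_mul (φ : κ → UnitAddTorus d → ℝ) (a b : κ) (T₁ T₂ : DiffMonomial d κ)
    (x : UnitAddTorus d) : eval φ a b (mul T₁ T₂) x = eval φ a b T₁ x * eval φ a b T₂ x := by
  simp only [eval, mul, prodEval_append]; ring

omit [Fintype d] in
/-- Evaluation of a single factor. [folklore] -/
@[simp] theorem eval_single (φ : κ → UnitAddTorus d → ℝ) (a b : κ) (v : List d) (k : κ)
    (x : UnitAddTorus d) : eval φ a b (single v k) x = iterPartialDeriv v (φ k) x := by
  simp [eval, single, prodEval]

omit [Fintype d] in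
/-- Evaluation of a scaled monomial. [folklore] -/
theorem eval_scale (φ : κ → UnitAddTorus d → ℝ) (a b : κ) (g : ℝ → ℝ → ℝ) (T : DiffMonomial d κ)
    (x : UnitAddTorus d) : eval φ a b (scale g T) x = g (φ a x) (φ b x) * eval φ a b T x := by
  simp only [eval, scale]; ring

end AlgebraEval

/-- Shape of a product. [folklore] -/
theorem order_mul (T₁ T₂ : DiffMonomial d κ) : (mul T₁ T₂).order = T₁.order + T₂.order := by
  simp [order, mul, List.sum_append]

/-- Width of a product. [folklore] -/
theorem width_mul (T₁ T₂ : DiffMonomial d κ) : (mul T₁ T₂).width = T₁.width + T₂.width := by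
  simp [width, mul]

/-- Properness of a product. [folklore] -/
theorem Proper.mul {T₁ T₂ : DiffMonomial d κ} (h₁ : T₁.Proper) (h₂ : T₂.Proper) : (mul T₁ T₂).Proper := by
  intro f hf
  change f ∈ T₁.factors ++ T₂.factors at hf
  rw [List.mem_append] at hf
  rcases hf with hf | hf
  · exact h₁ f hf
  · exact h₂ f hf

/-- Shape of a single factor. [folklore] -/
@[simp] theorem order_single (v : List d) (k : κ) : (single v k : DiffMonomial d κ).order = v.length := by
  simp [order, single]

/-- Width of a single factor. [folklore] -/
@[simp] theorem width_single (v : List d) (k : κ) : (single v k : DiffMonomial d κ).width = 1 := by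
  simp [width, single]

/-- A single factor with a nonempty word is proper. [folklore] -/
theorem proper_single {v : List d} (hv : v ≠ []) (k : κ) : (single v k : DiffMonomial d κ).Proper := by
  intro f hf
  simp only [single, List.mem_singleton] at hf
  subst hf; exact hv

/-- Shape of a scaled monomial. [folklore] -/
@[simp] theorem order_scale (g : ℝ → ℝ → ℝ) (T : DiffMonomial d κ) : (scale g T).order = T.order := rfl

/-- Width of a scaled monomial. [folklore] -/
@[simp] theorem width_scale (g : ℝ → ℝ → ℝ) (T : DiffMonomial d κ) : (scale g T).width = T.width := rfl

/-- Properness of a scaled monomial. [folklore] -/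
theorem Proper.scale {T : DiffMonomial d κ} (h : T.Proper) (g : ℝ → ℝ → ℝ) : (scale g T).Proper := h

/-- Factors of a scaled monomial. [folklore] -/
@[simp] theorem factors_scale (g : ℝ → ℝ → ℝ) (T : DiffMonomial d κ) : (scale g T).factors = T.factors := rfl

/-- Coefficient of a scaled monomial. [folklore] -/
@[simp] theorem coeff_scale (g : ℝ → ℝ → ℝ) (T : DiffMonomial d κ) :
    (scale g T).coeff = fun r θ => g r θ * T.coeff r θ := rfl

/-! ### Partial derivatives of the coefficient -/

/-- The first partial derivative `∂₁g` of a coefficient (slice derivative). [folklore] -/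
def dR (g : ℝ → ℝ → ℝ) (r θ : ℝ) : ℝ := deriv (fun r' => g r' θ) r

/-- The second partial derivative `∂₂g` of a coefficient (slice derivative). [folklore] -/
def dT (g : ℝ → ℝ → ℝ) (r θ : ℝ) : ℝ := deriv (fun θ' => g r θ') θ

section CoeffCalculus

variable {g : ℝ → ℝ → ℝ} {U : Set (ℝ × ℝ)}

/-- On an open set where `g` is `C^∞`, `∂₁g` is the Fréchet derivative applied to `(1, 0)`.
[folklore] -/
theorem dR_eq_fderiv (hg : ContDiffOn ℝ ∞ (uncurry g) U) (hU : IsOpen U) {r θ : ℝ} (h : (r, θ) ∈ U) :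
    dR g r θ = _root_.fderiv ℝ (uncurry g) (r, θ) (1, 0) := by
  obtain ⟨-, hF'⟩ := hasFDerivAt_uncurry_of_contDiffOn hg hU (by simp) h
  rw [hF' 1 0, dR]; ring

/-- On an open set where `g` is `C^∞`, `∂₂g` is the Fréchet derivative applied to `(0, 1)`.
[folklore] -/
theorem dT_eq_fderiv (hg : ContDiffOn ℝ ∞ (uncurry g) U) (hU : IsOpen U) {r θ : ℝ} (h : (r, θ) ∈ U) :
    dT g r θ = _root_.fderiv ℝ (uncurry g) (r, θ) (0, 1) := by
  obtain ⟨-, hF'⟩ := hasFDerivAt_uncurry_of_contDiffOn hg hU (by simp) h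
  rw [hF' 0 1, dT]; ring

/-- `∂₁g` is `C^∞` on the open set where `g` is. [folklore] -/
theorem contDiffOn_dR (hg : ContDiffOn ℝ ∞ (uncurry g) U) (hU : IsOpen U) :
    ContDiffOn ℝ ∞ (uncurry (dR g)) U := by
  have h1 : ContDiffOn ℝ ∞ (fun q : ℝ × ℝ => _root_.fderiv ℝ (uncurry g) q (1, 0)) U :=
    (hg.fderiv_of_isOpen hU (by simp)).clm_apply contDiffOn_const
  refine h1.congr ?_
  rintro ⟨r, θ⟩ h
  exact dR_eq_fderiv hg hU h

/-- `∂₂g` is `C^∞` on the open set where `g` is. [folklore] -/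
theorem contDiffOn_dT (hg : ContDiffOn ℝ ∞ (uncurry g) U) (hU : IsOpen U) :
    ContDiffOn ℝ ∞ (uncurry (dT g)) U := by
  have h1 : ContDiffOn ℝ ∞ (fun q : ℝ × ℝ => _root_.fderiv ℝ (uncurry g) q (0, 1)) U :=
    (hg.fderiv_of_isOpen hU (by simp)).clm_apply contDiffOn_const
  refine h1.congr ?_
  rintro ⟨r, θ⟩ h
  exact dT_eq_fderiv hg hU h

/-- Products of coefficients `C^∞` on `U` are `C^∞` on `U`. [folklore] -/
theorem contDiffOn_uncurry_mul {g₁ g₂ : ℝ → ℝ → ℝ} (h₁ : ContDiffOn ℝ ∞ (uncurry g₁) U)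
    (h₂ : ContDiffOn ℝ ∞ (uncurry g₂) U) :
    ContDiffOn ℝ ∞ (uncurry fun r θ => g₁ r θ * g₂ r θ) U := by
  have h : (uncurry fun r θ => g₁ r θ * g₂ r θ) = fun q => uncurry g₁ q * uncurry g₂ q := by
    funext q; rfl
  rw [h]; exact h₁.mul h₂

end CoeffCalculus

/-! ### The `∂ᵢ`-expansion -/

/-- Leibniz on the factor list: the lists obtained by putting one more derivative `∂ᵢ` on one
of the factors. [folklore] -/
def dFactors (i : d) : List (List d × κ) → List (List (List d × κ))
  | [] => []
  | f :: fs => ((i :: f.1, f.2) :: fs) :: (dFactors i fs).map (f :: ·)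

/-- **The `∂ᵢ`-expansion of a monomial**: chain rule on the coefficient (two monomials, with a new
factor `∂ᵢφ_a`, resp. `∂ᵢφ_b`, and coefficient `∂₁g`, resp. `∂₂g`) and Leibniz on the product
(one monomial per factor). [cite: TaylorPDEIII2011, Ch. 13 §3] -/
def dExp (a b : κ) (i : d) (T : DiffMonomial d κ) : List (DiffMonomial d κ) :=
  ⟨dR T.coeff, ([i], a) :: T.factors⟩ :: ⟨dT T.coeff, ([i], b) :: T.factors⟩ ::
    (dFactors i T.factors).map fun fs => ⟨T.coeff, fs⟩

/-- **The `∂^w`-expansion** (head of the word outermost, as `Torus.iterPartialDeriv`). [folklore] -/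
def wExp (a b : κ) : List d → DiffMonomial d κ → List (DiffMonomial d κ)
  | [], T => [T]
  | i :: w, T => (wExp a b w T).flatMap (dExp a b i)

/-! #### Shape invariants of the expansions -/

section ShapeInvariants

/-- Members of `dFactors i fs`: same length, order one more, properness preserved, and every
factor order grows by at most one. [folklore] -/
theorem mem_dFactors {i : d} : ∀ {fs gs : List (List d × κ)}, gs ∈ dFactors i fs →
    gs.length = fs.length ∧ orderOf gs = orderOf fs + 1 ∧ ((∀ f ∈ fs, f.1 ≠ []) → ∀ f ∈ gs, f.1 ≠ []) ∧
      (∀ n : ℕ, (∀ f ∈ fs, f.1.length ≤ n) → ∀ f ∈ gs, f.1.length ≤ n + 1) := by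
  intro fs
  induction fs with
  | nil => intro gs h; simp [dFactors] at h
  | cons f fs ih =>
    intro gs h
    simp only [dFactors, List.mem_cons, List.mem_map] at h
    rcases h with rfl | ⟨gs', hgs', rfl⟩
    · refine ⟨by simp, by simp [orderOf]; ring, fun hp => ?_, fun n hn => ?_⟩
      · intro f' hf'
        rcases List.mem_cons.1 hf' with rfl | h'
        · simp
        · exact hp f' (List.mem_cons_of_mem _ h')
      · intro f' hf'
        rcases List.mem_cons.1 hf' with rfl | h'
        · simp only [List.length_cons]
          exact Nat.succ_le_succ (hn f List.mem_cons_self)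
        · exact (hn f' (List.mem_cons_of_mem _ h')).trans (Nat.le_succ _)
    · obtain ⟨hlen, hord, hprop, hmax⟩ := ih hgs'
      refine ⟨by simp [hlen], by simp [hord]; ring, fun hp => ?_, fun n hn => ?_⟩
      · intro f' hf'
        rcases List.mem_cons.1 hf' with rfl | h'
        · exact hp _ List.mem_cons_self
        · exact hprop (fun f'' hf'' => hp f'' (List.mem_cons_of_mem _ hf'')) f' h'
      · intro f' hf'
        rcases List.mem_cons.1 hf' with rfl | h'
        · exact (hn _ List.mem_cons_self).trans (Nat.le_succ _)
        · exact hmax n (fun f'' hf'' => hn f'' (List.mem_cons_of_mem _ hf'')) f' h'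

/-- **Shape of the `∂ᵢ`-expansion**: order one more, width the same or one more, properness
preserved, maximal order at most one more. [folklore] -/
theorem mem_dExp {a b : κ} {i : d} {T T' : DiffMonomial d κ} (h : T' ∈ dExp a b i T) :
    T'.order = T.order + 1 ∧ (T'.width = T.width ∨ T'.width = T.width + 1) ∧
      (T.Proper → T'.Proper) ∧ T'.maxOrder ≤ T.maxOrder + 1 := by
  have hmaxT : ∀ f ∈ T.factors, f.1.length ≤ T.maxOrder := fun f hf => length_le_maxOrder hf
  -- a criterion for `maxOrder ≤ n`
  have hcrit : ∀ (S : DiffMonomial d κ) (n : ℕ), (∀ f ∈ S.factors, f.1.length ≤ n) → S.maxOrder ≤ n := by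
    intro S n hS
    by_cases hS0 : S.factors = []
    · unfold maxOrder; rw [hS0]; simp
    · obtain ⟨f, hf, hfe⟩ := exists_length_eq_maxOrder S hS0
      rw [← hfe]; exact hS f hf
  simp only [dExp, List.mem_cons, List.mem_map] at h
  rcases h with rfl | rfl | ⟨gs, hgs, rfl⟩
  · refine ⟨by simp [order_eq]; omega, Or.inr (by simp [width]), fun hp => ?_, hcrit _ _ ?_⟩
    · intro f hf
      rcases List.mem_cons.1 hf with rfl | h'
      · simp
      · exact hp f h'
    · intro f hf
      rcases List.mem_cons.1 hf with rfl | h'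
      · simp
      · exact (hmaxT f h').trans (Nat.le_succ _)
  · refine ⟨by simp [order_eq]; omega, Or.inr (by simp [width]), fun hp => ?_, hcrit _ _ ?_⟩
    · intro f hf
      rcases List.mem_cons.1 hf with rfl | h'
      · simp
      · exact hp f h'
    · intro f hf
      rcases List.mem_cons.1 hf with rfl | h'
      · simp
      · exact (hmaxT f h').trans (Nat.le_succ _)
  · obtain ⟨hlen, hord, hprop, hmax⟩ := mem_dFactors hgs
    exact ⟨by simp only [order_eq]; exact hord, Or.inl (by simp only [width]; exact hlen),
      fun hp => hprop hp, hcrit _ _ (hmax _ hmaxT)⟩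

/-- **Shape of the `∂^w`-expansion**: `order T' = order T + |w|`, `width T ≤ width T' ≤ width T + |w|`,
properness preserved, `maxOrder T' ≤ maxOrder T + |w|`. [folklore] -/
theorem mem_wExp {a b : κ} : ∀ {w : List d} {T T' : DiffMonomial d κ}, T' ∈ wExp a b w T →
    T'.order = T.order + w.length ∧ T.width ≤ T'.width ∧ T'.width ≤ T.width + w.length ∧
      (T.Proper → T'.Proper) ∧ T'.maxOrder ≤ T.maxOrder + w.length := by
  intro w
  induction w with
  | nil =>
    intro T T' h
    simp only [wExp, List.mem_singleton] at h
    subst h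
    simp
  | cons i w ih =>
    intro T T' h
    simp only [wExp, List.mem_flatMap] at h
    obtain ⟨S, hS, hT'⟩ := h
    obtain ⟨hSo, hSw₁, hSw₂, hSp, hSm⟩ := ih hS
    obtain ⟨hTo, hTw, hTp, hTm⟩ := mem_dExp hT'
    refine ⟨by rw [hTo, hSo]; simp; ring, ?_, ?_, fun hp => hTp (hSp hp), ?_⟩
    · rcases hTw with h | h <;> omega
    · rcases hTw with h | h
      · rw [h]; simp; omega
      · rw [h]; simp; omega
    · simp only [List.length_cons]; omega

/-- **Coefficients of the expansions are smooth where the original coefficient is.** [folklore] -/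
theorem contDiffOn_coeff_of_mem_dExp {a b : κ} {i : d} {T T' : DiffMonomial d κ} {U : Set (ℝ × ℝ)}
    (hU : IsOpen U) (hg : ContDiffOn ℝ ∞ (uncurry T.coeff) U) (h : T' ∈ dExp a b i T) :
    ContDiffOn ℝ ∞ (uncurry T'.coeff) U := by
  simp only [dExp, List.mem_cons, List.mem_map] at h
  rcases h with rfl | rfl | ⟨gs, -, rfl⟩
  · exact contDiffOn_dR hg hU
  · exact contDiffOn_dT hg hU
  · exact hg

/-- Coefficients of the `∂^w`-expansion are smooth where the original coefficient is. [folklore] -/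
theorem contDiffOn_coeff_of_mem_wExp {a b : κ} {U : Set (ℝ × ℝ)} (hU : IsOpen U) :
    ∀ {w : List d} {T T' : DiffMonomial d κ}, ContDiffOn ℝ ∞ (uncurry T.coeff) U →
      T' ∈ wExp a b w T → ContDiffOn ℝ ∞ (uncurry T'.coeff) U := by
  intro w
  induction w with
  | nil =>
    intro T T' hg h
    simp only [wExp, List.mem_singleton] at h
    subst h; exact hg
  | cons i w ih =>
    intro T T' hg h
    simp only [wExp, List.mem_flatMap] at h
    obtain ⟨S, hS, hT'⟩ := h
    exact contDiffOn_coeff_of_mem_dExp hU (ih hg hS) hT'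

end ShapeInvariants

/-! #### The expansions compute the derivatives -/

section Derivatives

variable [Fintype d] [DecidableEq d]
variable {φ : κ → UnitAddTorus d → ℝ} {a b : κ} {U : Set (ℝ × ℝ)}

/-- Products of factors are smooth. [folklore] -/
theorem isSmooth_prodEval (hφ : ∀ k, IsSmooth (φ k)) :
    ∀ fs : List (List d × κ), IsSmooth (prodEval φ fs)
  | [] => by
    have h : prodEval φ ([] : List (List d × κ)) = fun _ => (1 : ℝ) := funext fun x => by simp
    rw [h]; exact isSmooth_const (1 : ℝ)
  | f :: fs => by
    have h1 : IsSmooth (iterPartialDeriv f.1 (φ f.2)) := (hφ f.2).iterPartialDeriv f.1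
    have h2 := isSmooth_prodEval hφ fs
    have h : prodEval φ (f :: fs) = fun x => iterPartialDeriv f.1 (φ f.2) x * prodEval φ fs x := by
      funext x; exact prodEval_cons φ f fs x
    rw [h]
    exact (ContDiff.mul h1 h2 : IsSmooth fun x => iterPartialDeriv f.1 (φ f.2) x * prodEval φ fs x)

omit [DecidableEq d] in
/-- The coefficient field `x ↦ g(φ a x, φ b x)` is smooth when `g` is smooth on an open set
containing the values. [folklore] -/
theorem isSmooth_coeffField (hφ : ∀ k, IsSmooth (φ k)) {g : ℝ → ℝ → ℝ}
    (hg : ContDiffOn ℝ ∞ (uncurry g) U) (hmem : ∀ x, (φ a x, φ b x) ∈ U) :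
    IsSmooth (fun x => g (φ a x) (φ b x)) := by
  have h : lift (fun x => g (φ a x) (φ b x)) = uncurry g ∘ fun y => (lift (φ a) y, lift (φ b) y) := by
    funext y; rfl
  show ContDiff ℝ ∞ (lift fun x => g (φ a x) (φ b x))
  rw [h]
  exact hg.comp_contDiff ((hφ a).prodMk (hφ b)) fun y => hmem _

/-- Evaluations of monomials are smooth. [folklore] -/
theorem isSmooth_eval (hφ : ∀ k, IsSmooth (φ k)) {T : DiffMonomial d κ}
    (hg : ContDiffOn ℝ ∞ (uncurry T.coeff) U) (hmem : ∀ x, (φ a x, φ b x) ∈ U) :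
    IsSmooth (eval φ a b T) :=
  (ContDiff.mul (isSmooth_coeffField hφ hg hmem) (isSmooth_prodEval hφ T.factors) :
    IsSmooth fun x => T.coeff (φ a x) (φ b x) * prodEval φ T.factors x)

/-- **Leibniz on the factor product**: `∂ᵢ Π_l ∂^{v_l}φ_{k_l} = Σ_l (… ∂ᵢ∂^{v_l}φ_{k_l} …)`.
[cite: Evans2010, App. C.2] -/
theorem partialDeriv_prodEval (hφ : ∀ k, IsSmooth (φ k)) (i : d) :
    ∀ (fs : List (List d × κ)) (x : UnitAddTorus d),
      partialDeriv i (prodEval φ fs) x = ((dFactors i fs).map fun gs => prodEval φ gs x).sum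
  | [], x => by
    have h : prodEval φ ([] : List (List d × κ)) = fun _ => (1 : ℝ) := by funext y; simp
    have hc := iterPartialDeriv_const (d := d) (1 : ℝ) [i] (by simp)
    simp only [iterPartialDeriv_cons, iterPartialDeriv_nil] at hc
    rw [h, congrFun hc x]
    simp [dFactors]
  | f :: fs, x => by
    have h1 : IsSmooth (iterPartialDeriv f.1 (φ f.2)) := (hφ f.2).iterPartialDeriv f.1
    have h2 := isSmooth_prodEval hφ fs
    have h : prodEval φ (f :: fs) = fun y => iterPartialDeriv f.1 (φ f.2) y * prodEval φ fs y := by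
      funext y; exact prodEval_cons φ f fs y
    rw [h, partialDeriv_mul (h1.isContDiff (by simp)) (h2.isContDiff (by simp)),
      partialDeriv_prodEval hφ i fs x]
    simp only [dFactors, List.map_cons, List.map_map, List.sum_cons, prodEval_cons,
      iterPartialDeriv_cons, Function.comp_def]
    rw [List.sum_map_mul_left]
    ring

/-- **The `∂ᵢ`-expansion computes `∂ᵢ`**: `∂ᵢ (eval T) = Σ_{T' ∈ dExp i T} eval T'`.
[cite: TaylorPDEIII2011, Ch. 13 §3] -/
theorem partialDeriv_eval (hφ : ∀ k, IsSmooth (φ k)) (hU : IsOpen U) {T : DiffMonomial d κ}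
    (hg : ContDiffOn ℝ ∞ (uncurry T.coeff) U) (hmem : ∀ x, (φ a x, φ b x) ∈ U) (i : d)
    (x : UnitAddTorus d) :
    partialDeriv i (eval φ a b T) x = ((dExp a b i T).map fun T' => eval φ a b T' x).sum := by
  have hc : IsSmooth (fun x => T.coeff (φ a x) (φ b x)) := isSmooth_coeffField hφ hg hmem
  have hP := isSmooth_prodEval hφ T.factors
  have hev : eval φ a b T = fun y => T.coeff (φ a y) (φ b y) * prodEval φ T.factors y := rfl
  rw [hev, partialDeriv_mul (hc.isContDiff (by simp)) (hP.isContDiff (by simp)),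
    partialDeriv_comp₂ hg hU (by simp) ((hφ a).isContDiff (by simp)) ((hφ b).isContDiff (by simp)) x
      (hmem x) i, partialDeriv_prodEval hφ i T.factors x]
  simp only [dExp, List.map_cons, List.map_map, List.sum_cons, eval, prodEval_cons,
    iterPartialDeriv_cons, iterPartialDeriv_nil, Function.comp_def, dR, dT]
  rw [List.sum_map_mul_left]
  ring

omit [DecidableEq d] in
/-- Finite list sums of smooth functions are smooth. [folklore] -/
theorem isSmooth_list_sum {α : Type*} (l : List α) {F : α → UnitAddTorus d → ℝ}
    (hF : ∀ s ∈ l, IsSmooth (F s)) : IsSmooth (fun y => (l.map fun s => F s y).sum) := by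
  induction l with
  | nil => simpa using (isSmooth_const (0 : ℝ) : IsSmooth fun _ : UnitAddTorus d => (0 : ℝ))
  | cons s l ih =>
    have h1 : IsSmooth (F s) := hF s List.mem_cons_self
    have h2 := ih fun s' hs' => hF s' (List.mem_cons_of_mem _ hs')
    simp only [List.map_cons, List.sum_cons]
    show IsSmooth (F s + fun y => (l.map fun s => F s y).sum)
    exact h1.add h2

/-- Partial derivative of a finite list sum of smooth functions. [folklore] -/
theorem partialDeriv_list_sum {α : Type*} (l : List α) {F : α → UnitAddTorus d → ℝ}
    (hF : ∀ s ∈ l, IsSmooth (F s)) (i : d) (x : UnitAddTorus d) :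
    partialDeriv i (fun y => (l.map fun s => F s y).sum) x = (l.map fun s => partialDeriv i (F s) x).sum := by
  induction l with
  | nil =>
    have hc := iterPartialDeriv_const (d := d) (0 : ℝ) [i] (by simp)
    simp only [iterPartialDeriv_cons, iterPartialDeriv_nil] at hc
    simp only [List.map_nil, List.sum_nil]
    exact congrFun hc x
  | cons s l ih =>
    have hs : IsSmooth (F s) := hF s List.mem_cons_self
    have hl : ∀ s' ∈ l, IsSmooth (F s') := fun s' hs' => hF s' (List.mem_cons_of_mem _ hs')
    have hsum : IsSmooth (fun y => (l.map fun s => F s y).sum) := isSmooth_list_sum l hl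
    simp only [List.map_cons, List.sum_cons]
    have hadd := congrFun (partialDeriv_add (hs.isContDiff (by simp)) (hsum.isContDiff (by simp)) i) x
    simp only [Pi.add_apply] at hadd
    rw [show (fun y => F s y + (l.map fun s => F s y).sum) = (F s + fun y => (l.map fun s => F s y).sum)
      from rfl, hadd, ih hl]

omit [Fintype d] [DecidableEq d] in
/-- Sums over a `flatMap`. [folklore] -/
theorem sum_flatMap_eq {α : Type*} (l : List α) (G : α → List ℝ) :
    (l.flatMap G).sum = (l.map fun s => (G s).sum).sum := by
  induction l with
  | nil => simp
  | cons s l ih => simp [List.sum_append, ih]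

/-- **The `∂^w`-expansion computes `∂^w`**: `∂^w (eval T) = Σ_{T' ∈ wExp w T} eval T'`.
[cite: TaylorPDEIII2011, Ch. 13 §3] -/
theorem iterPartialDeriv_eval (hφ : ∀ k, IsSmooth (φ k)) (hU : IsOpen U)
    (hmem : ∀ x, (φ a x, φ b x) ∈ U) :
    ∀ (w : List d) {T : DiffMonomial d κ} (_ : ContDiffOn ℝ ∞ (uncurry T.coeff) U) (x : UnitAddTorus d),
      iterPartialDeriv w (eval φ a b T) x = ((wExp a b w T).map fun T' => eval φ a b T' x).sum
  | [], T, _, x => by simp [wExp]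
  | i :: w, T, hg, x => by
    rw [iterPartialDeriv_cons]
    have hfun : iterPartialDeriv w (eval φ a b T) = fun y => ((wExp a b w T).map fun T' => eval φ a b T' y).sum :=
      funext fun y => iterPartialDeriv_eval hφ hU hmem w hg y
    rw [hfun, partialDeriv_list_sum (wExp a b w T)
      (fun S hS => isSmooth_eval hφ (contDiffOn_coeff_of_mem_wExp hU hg hS) hmem) i x]
    simp only [wExp]
    rw [List.map_flatMap, sum_flatMap_eq]
    congr 1
    exact List.map_congr_left fun S hS =>
      partialDeriv_eval hφ hU (contDiffOn_coeff_of_mem_wExp hU hg hS) hmem i x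

end Derivatives

end DiffMonomial

end Torus

end Literature.Analysis.FunctionSpaces

end
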